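import Summits.CriticalPhenomena.Ising3DConformalLimit.Theorems.PerfectScreeningCoulombImpliesNontrivialEssentialityCriterion
import Literature.Probability.LatticeModels.TwoCurrentClusterCalculus
import HarnessLib

/-!
# STRATEGY-CENSUS, Decomposition D2 — the best typed split of S_B `stub_spreadDefectsEssential` (sketch, NOT registered)

Crux-strategist planner-cstrat-stmt-CriticalPhenomena-13885-s1-0, 2026-08-17. Typed signatures (defs elaborate; nothing is
proved or registered here) of the cut-set split of the open heart S_B of line `merging-is-expected-screening`:

  S_B ⟸ (PZ on `N_C := #{v ∈ C : v is a cut vertex for c–e in the trace of (n + m)}`)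
      ⟸ `CutDensityFloor q`  (Sub₁: first moment, a LOWER bound on the density of cut vertices, codimension `q = 3 − p`)
       + `CutPairCeiling q`   (Sub₂: second moment, quasi-multiplicative UPPER bound on pairs of cut vertices)
       + potential theory     (Sub₃: for a spread `s`-set with `s > q`, `(E N_C)² ≥ c · E N_C²` — elementary from
                               `IsSpreadDefect`: `I_q(C) ≤ (2K R)^{s−q} I_s(C) ≤ λ(2K)^{s−q} R^{−q} #C²`, `#C ≥ ν R^s ≥ ν R^q`).

Why `{v ∈ C cut vertex of ω} ⊆ ESSENTIAL(C)`: the sourceless current `p.1` is supported off `C`, so every bond of the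
trace `ω` at `v ∈ C` belongs to `p.2`; removing the bonds touching `C` removes in particular those at `v`, hence
disconnects `c` from `e` (the event of S_B, `liftBonds 3 L ((p.1+p.2).tracedIn (offGraph … C)) ∉ openConn c e`).
WHICH PIECE IS THE WHOLE CRUX: Sub₁ with `q < 2` (cut-set dimension `p = 1/ν_Russo > 1`): lead c5/c6's named first
input "(ν<1)_Russo" — d = 3-specific (in d = 4, `p = 2 = s_max`, marginal; false-in-kind for d ≥ 5), no printed or
sketched engine (every rigorous pivotal statement is an identity `Σ_b d_b = (t/(1−t⟨ε⟩)) ∂_β log G` or an upper bound).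
Sub₂ is an upper bound (right side of the technology) but also unproved; Sub₃ is routine. By the protocol's own
definition this split hides the difficulty in one child (a shred), so it is RECORDED, not filed.
-/

noncomputable section

namespace Summit.CriticalPhenomena.Ising3DConformalLimit.Cruxes.CoulombImpliesNontrivial.MergingIsExpectedScreening.StrategistSplit

open Filter Topology Set MeasureTheory Finset
open Literature.Probability.LatticeModels Literature.Probability.Percolation
open scoped symmDiff ENNReal

/-- The lifted trace (bond configuration of `ℤ³`) of the pair `(m, n) = (p.1, p.2)` in the box `Λ_L`. -/
def pairTrace (L : ℕ) (p : Current (freeBoxGraph 3 L) × Current (freeBoxGraph 3 L)) : BondConfig (Site 3) :=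
  liftBonds 3 L (p.1 + p.2).traced

/-- `v` is a CUT VERTEX for the `c–e` connection of `ω`: `c ↔ e` in `ω`, but not after deleting the bonds at `v`. -/
def IsCutVertexFor (c e v : Site 3) (ω : BondConfig (Site 3)) : Prop :=
  ω ∈ openConn c e ∧ (ω ∩ {b : Sym2 (Site 3) | v ∉ b}) ∉ openConn c e

/-- The un-normalised product mass of an event `E` under (sourceless current off `C`) ⊗ (current with sources `{c}∆{e}`),
exactly the shape of S_B's right-hand side. -/
def essMass (L : ℕ) (C : Finset (Site 3)) (c e : Site 3)
    (E : Set (Current (freeBoxGraph 3 L) × Current (freeBoxGraph 3 L))) : ℝ≥0∞ :=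
  ∑' p : Current (freeBoxGraph 3 L) × Current (freeBoxGraph 3 L),
    (if Current.IsSupp (offGraph (freeBoxGraph 3 L) (boxSources 3 L C)) p.1 ∧ p.1.sources = ∅
      then p.1.eweight (fun _ : (freeBoxGraph 3 L).edgeFinset => criticalBeta 3) else 0) *
    (if p.2.sources = boxSources 3 L ({c} ∆ {e})
      then p.2.eweight (fun _ : (freeBoxGraph 3 L).edgeFinset => criticalBeta 3) else 0) *
    E.indicator 1 p

/-- The normaliser `Z_{off C}[∅] · Z[ce]` of S_B. -/
def essNorm (L : ℕ) (C : Finset (Site 3)) (c e : Site 3) : ℝ≥0∞ :=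
  ecurrentSumIn (offGraph (freeBoxGraph 3 L) (boxSources 3 L C))
      (fun _ : (freeBoxGraph 3 L).edgeFinset => criticalBeta 3) ∅ *
    ecurrentSum (fun _ : (freeBoxGraph 3 L).edgeFinset => criticalBeta 3) (boxSources 3 L ({c} ∆ {e}))

/-- **Sub₁ `CutDensityFloor q`** (THE WHOLE CRUX; "(ν<1)_Russo", cut-set codimension `q = 3 − 1/ν < 2`): for axial far
pairs and every defect `C` avoiding `c, e`, every site `v` of the middle region is a cut vertex of the `c–e` connection
of the traced pair with mass at least `κ ‖c−e‖^{−q}` (relative to the normaliser). -/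
def CutDensityFloor (q : ℝ) : Prop :=
  ∃ κ : ℝ, 0 < κ ∧ ∃ R₀ : ℝ, ∀ c e : Site 3, (∀ j : Fin 3, j ≠ 0 → e j = c j) → R₀ ≤ ‖c - e‖ →
    ∀ᶠ L : ℕ in atTop, ∀ C : Finset (Site 3), c ∉ C → e ∉ C →
      ∀ v : Site 3, ‖c - e‖ ≤ 4 * ‖v - c‖ → ‖c - e‖ ≤ 4 * ‖v - e‖ → ‖v - c‖ ≤ 2 * ‖c - e‖ →
        ENNReal.ofReal (κ * (‖c - e‖ : ℝ) ^ (-q)) * essNorm L C c e ≤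
          essMass L C c e {p | IsCutVertexFor c e v (pairTrace L p)}

/-- **Sub₂ `CutPairCeiling q`** (quasi-multiplicative second moment of the cut set, an UPPER bound): two distinct sites
are simultaneously cut vertices with mass at most `K' ‖c−e‖^{−q} ‖u−v‖^{−q}`. -/
def CutPairCeiling (q : ℝ) : Prop :=
  ∃ K' : ℝ, ∃ R₀ : ℝ, ∀ c e : Site 3, (∀ j : Fin 3, j ≠ 0 → e j = c j) → R₀ ≤ ‖c - e‖ →
    ∀ᶠ L : ℕ in atTop, ∀ C : Finset (Site 3), c ∉ C → e ∉ C →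
      ∀ u v : Site 3, u ≠ v →
        essMass L C c e {p | IsCutVertexFor c e u (pairTrace L p) ∧ IsCutVertexFor c e v (pairTrace L p)} ≤
          ENNReal.ofReal (K' * (‖c - e‖ : ℝ) ^ (-q) * (‖u - v‖ : ℝ) ^ (-q)) * essNorm L C c e

/-- **Glue target (stated, not proved)**: Sub₁ + Sub₂ at some codimension `q < 2` give the matrix of S_B at every
`s ∈ (q, 2)` (Paley–Zygmund on `N_C` + the inclusion "cut vertex in `C` ⇒ `C` essential" + the energy comparison
`I_q ≤ (2KR)^{s−q} I_s`). This is the statement a prover would land as `…Split.lean` if the split were filed. -/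
def GlueTarget : Prop :=
  ∀ q : ℝ, 1 ≤ q → q < 2 → CutDensityFloor q → CutPairCeiling q →
    ∀ s : ℝ, q < s → s < 2 → ∀ K lam nu : ℝ, 0 < K → 0 < lam → 0 < nu →
      ∃ c' : ℝ, 0 < c' ∧ c' ≤ 1 ∧ ∃ R₀ : ℝ, ∀ c e : Site 3, (∀ j : Fin 3, j ≠ 0 → e j = c j) →
        R₀ ≤ ‖c - e‖ → ∀ᶠ L : ℕ in atTop, ∀ C : Finset (Site 3), c ∉ C → e ∉ C →
          Summit.CriticalPhenomena.Ising3DConformalLimit.Cruxes.GaussianLimitNotScreened.KaramataAmplitudeBlindMerging.IsSpreadDefect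
              s K lam nu c e C →
          ENNReal.ofReal c' * essNorm L C c e ≤
            essMass L C c e {q' | liftBonds 3 L ((q'.1 + q'.2).tracedIn (offGraph (freeBoxGraph 3 L) (boxSources 3 L C))) ∉
                openConn c e}

end Summit.CriticalPhenomena.Ising3DConformalLimit.Cruxes.CoulombImpliesNontrivial.MergingIsExpectedScreening.StrategistSplit

end
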